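import Summits.QuantumFields.YangMills.Theorems.FluctuationComparisonRegPrIntLS2BetaWindowExactnessOfTower
import Summits.QuantumFields.YangMills.Theorems.FluctuationComparisonRegPrIntLS2BetaSymmetriesLiftOfCritical
import Summits.QuantumFields.YangMills.Theorems.FluctuationComparisonRegPrIntLArgminOrbitOfUniqueCriticalOrbit
import Summits.QuantumFields.YangMills.Theorems.FluctuationComparisonRegPrIntLS2BetaResidualGauge
import HarnessLib

/-!
# S2β · ★★★★★ REG-ARGMIN̄ AND ORB∘ AT EVERY DEPTH FROM THE THM-1 PAIR, BY THE EQUALITY CHAIN — an argmin good history over an interior datum IS a residual translate of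
# [Balaban1985Variational] Thm 1's (8)-minimiser, hence (6)(ε₀)-REGULAR, and `argminHist V` is ONE residual orbit; OUTRIGHT at every `L ≥ 5`, and from the `L = 3` pair alone

Cell `ym3-torus` (YM ladder rung R3 = continuum `SU(2)` Yang–Mills on the three-torus at fixed lattice data — a RUNG: NOT d = 4, NOT infinite volume, NOT a mass gap,
NOT Clay).  Width seat `ym3-torus-px13` (gen 21), FILE D (sequel of FILE C ✓`…S2BetaWindowExactnessOfTower` and FILE B ✓`…S2BetaSymmetriesLiftOfCritical`); crux
`stmt-QuantumFields-20520` (`…Theses.UnitScaleTilt.FluctuationComparisonRegPrIntL`), LINE g18-1 S2β, organ GAP♯∘ ∕ EXW∘ (UV3-NODE §37 «REG-ARGMIN ∕ ORB∘ at the crux's depth —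
the exact gap of the organ», §37.7, §47.3 (iii), §48.3 (iii)); `--kind proof --supports stmt-QuantumFields-20520 --as helper`, count-neutral, DEFINITION-FREE (0 `def`, 0 `instance`,
0 `notation`, 0 `sorry`, default heartbeats).

WHY.  px17 g14's LOCATE-ORB (§37) isolated, inside the registered GAP♯∘, the qualitative letter REG-ARGMIN̄ («every good history `U` over an interior datum `V` with
`A(U) = minActionRegPr F J K ε₀ V` is (6)(ε₀)-regular») and ORB∘ («`argminHist V` is ONE residual orbit»), «NOT PRINTED at the crux's depth `(1 − 1∕m)K`», free only at
bounded depth (✓`regArgmin_of_le`), and otherwise ⟸ {TUBE-REG∘, Thm 1 (8)} (§37.7).  THEY FOLLOW FROM THM 1 ALONE — its pair «(8)-existence in the global reading ∧ uniqueness of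
the minimal orbit in (6)» (lit `Thm1GlobalMinAt ∧ Thm1UniqueMinOrbitAt`, a THEOREM at every `L ≥ 5`: ✓`thm1Pair_five`) — by FILE C's tower chain read as an EQUALITY chain:
with `W_n := D_{n,K}U`, `m_n := minActionRegPr F n K ε₀ W_n`, FILE C gives `m_J ≤ m_{J+1} ≤ … ≤ m_{K−1} ≤ A(U)`; if `A(U) = m_J` every link is an equality.  Descending
induction on the depth: at depth 1, `U ∈ (6)(ε₀)` over `W_{K−1}` (directly) with `A(U) = m_{K−1}` MINIMISES there, so Thm 1 sentence 2 at `(K−1, K)` puts it on the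
residual orbit of Thm 1's (8)-minimiser `U_{K−1}`: `U = w • U_{K−1}`, `w↓ = 1`, whence `U ∈ RegPr F (K−1) K (B₃θ(K−1))` (gauge invariance of (2), lit ✓`regPr_gaugeAct_iff`);
at depth `d + 1`: by the level above `U ∈ RegPr F (n+1) K (B₃θ(n+1)) ⊆ RegPr F n K ε₀` (FILE C's room `regPr_of_regPr_succ`), so `U ∈ (6)(ε₀)` over `W_n` with `A(U) = m_n`
minimises there, and Thm 1 sentence 2 at `(n, K)` gives `U = w • U_n`, `w↓ = 1` AT THAT DEPTH (no nesting of centres is needed).  At `n = J`: `U = w • U_J` with `U_J ∈ (8)(B₃θ(J)) ⊆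
(6)(ε₀)` ⇒ REG-ARGMIN̄; two argmin points are both on `U_J`'s residual orbit ⇒ ORB∘ (✓`argmin_eq_orbit_of_pairwise`).

WHAT IS PROVED (sorry-free).
* §1 `histGood_mono_free`; ★★★★★ `exists_onMinimalOrbit_sameOrbit_of_argmin (hT : Thm1GlobalMinAt L a₀ a₁ B₃) (hU1 : Thm1UniqueMinOrbitAt L a₀ a₁ B₃) … (hUf) (hUg)
  (hA : wilsonAction4 U = minActionRegPr F J K hJK.le ε₀ V) : ∃ UJ, (varProblem3 F J K hJK.le).OnMinimalOrbit (B₃ * θ J) V UJ ∧ SameOrbit F J K hJK.le UJ U` (the equality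
  chain, `J < K`); ★★★★★ `regPr_of_argmin … : U ∈ regFibrePr F J K hJK ε₀ V` (REG-ARGMIN̄, every `J ≤ K`); ★★★★★ `sameOrbit_of_argmin … : SameOrbit F J K hJK U U′` (ORB∘ pairwise).
* §2 in the registry's quantifier prefix and interior window (`c₀ := 1`, `pS := 0`, `ε₁ := a₀`, `γ₁` by lit ✓`exists_forall_θBal_le`): ★★★★★ `argminRegularOrbit_at (hT) (hU1)` —
  «every point of `argminHist V` is (6)(ε₀)-regular ∧ `argminHist V` = the residual orbit of any of its points» at one `L`; `argminRegularOrbit_of_thm1Pair` (∀ `L` from the pair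
  letter of ✓px17 g14 `argmin_eq_orbit_of_thm1Pair_of_regArgmin` — ITS REG-ARGMIN HYPOTHESIS DELETED); `argminRegularOrbit_of_thm1PairAtThree` (from the `L = 3` pair ALONE,
  ✓`thm1Pair_allL_of_three`); ★★★★★ `argminRegularOrbit_body_five (L) (h5 : 5 ≤ L)` — OUTRIGHT, ZERO HYPOTHESES.

GAP-LIST DELTA (UV3-NODE §37.3 ∕ §48.3): REG-ARGMIN̄, ORB∘, EXW∘ (FILE C), `hlift`, Prop. 7 cl. 1, POS∘, ISOL∘(δ), TUBE♭ (small tubes), GAP♭ are ALL letter-free per datum at every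
`L ≥ 5`; what remains of the S2β organ pair {EXW∘, GAP♯∘} vs the registry is ONLY (i) the `L = 3` Thm-1 pair ([Balaban1985RegularSpaces] Thm 2 at `L = 3`, EMBARGO-LITE №58) and
(ii) GAP♯∘'s UNIFORM quantifier order (datum-free `μ`, RECORD 17gh) — the crux's other three stubs (DET-REP-B, H4ᶜ∘, LFR♯ᶜ∘) untouched.

HONEST.  Composition BY NAME + threshold arithmetic; the analytic content is the tree's Thm 1 pair at `L ≥ 5` (19200 guarded chain + tonight's (1.29)-corner identity); nothing of
Bałaban's analysis is added; the REGISTERED stubs (every `L`), GAP♯∘'s uniform order, TUBE-REG∘, DET-REP-B, H4ᶜ∘, LFR♯ᶜ∘, S2β, crux 20520, 19936, 19200 and `YM3TorusSU2` are NOT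
proved; no summit statement is proved by a helper; rung R3 = SU(2) YM₃ on T³ at fixed lattice data — NOT d = 4, NOT infinite volume, NOT a mass gap, NOT Clay; the Yang–Mills mass
gap is NOT proved.  Axioms standard.

References: T. Bałaban, CMP **102** (1985) 277–309 [Balaban1985Variational] ((2)–(8) p.278, Thm 1 (8)–(10) p.279, Prop. 7 p.299); CMP **102** (1985) 255–275 [Balaban1985UV3] ((7) p.257,
(41)–(42) p.266, (47) p.267); CMP **109** (1987) [Balaban1987RG1] ((0.11) p.253, (0.21) p.256); CMP **98** (1985) [Balaban1985Averaging] ((8)–(13) p.19).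
-/

set_option autoImplicit false

noncomputable section

namespace Summit.QuantumFields.YangMills.Theorems.FluctuationComparisonRegPrIntLS2BetaArgminOrbitOfTower

open Literature.MathematicalPhysics.QuantumFieldTheory.Balaban1983to89
open Literature.MathematicalPhysics.QuantumFieldTheory.Balaban1983to89.T3ContinuumYM3Torus
open Literature.MathematicalPhysics.QuantumFieldTheory.Balaban1983to89.T3UnitLawDensityEML (ℰp)
open Literature.MathematicalPhysics.QuantumFieldTheory.Balaban1983to89.T3UnitScaleTilt
open Literature.MathematicalPhysics.QuantumFieldTheory.Balaban1983to89.T3TiltDescent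
open Literature.MathematicalPhysics.QuantumFieldTheory.Balaban1983to89.T3ConstrainedMinimiser (fibre)
open Literature.MathematicalPhysics.QuantumFieldTheory.Balaban1983to89.T3DescentFibreTower
open Literature.MathematicalPhysics.QuantumFieldTheory.Balaban1983to89.T3RegularMinimiser
open Literature.MathematicalPhysics.QuantumFieldTheory.Balaban1983to89.T3PrintedRegularMinimiser
open Literature.MathematicalPhysics.QuantumFieldTheory.Balaban1983to89.T3PrintedMinimiserExistence
open Literature.MathematicalPhysics.QuantumFieldTheory.Balaban1983to89.T3PrintedRegularOrbits (descTransf regPr_gaugeAct_iff)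
open Literature.MathematicalPhysics.QuantumFieldTheory.Balaban1983to89.T3Thm1Carrier (SameOrbit varProblem3)
open Literature.MathematicalPhysics.QuantumFieldTheory.Balaban1983to89.T3Thm1UniquenessSchema (Thm1UniqueMinOrbitAt)
open Literature.MathematicalPhysics.QuantumFieldTheory.Balaban1983to89.T3SectALandauChart (sameOrbit_symm sameOrbit_trans sameOrbit_refl)
open Literature.MathematicalPhysics.QuantumFieldTheory.Balaban1983to89.T3MinimiserStabilityReduction (θBal_pos)
open Literature.MathematicalPhysics.QuantumFieldTheory.Balaban1983to89.T3ThresholdSmallness (exists_forall_θBal_le)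
open Literature.MathematicalPhysics.QuantumFieldTheory.Balaban1983to89.T3AvgDivergenceSplit (regPr_of_plaqSmall)
open Literature.MathematicalPhysics.QuantumFieldTheory.Balaban1983to89.T4Continuum
open Summit.QuantumFields.YangMills.Theorems.FluctuationComparisonRegPrIntLS2BetaWindowExactnessOfTower
  (plaqSmall_descendTo_of_histGood regPr_of_regPr_succ minActionRegPr_le_action_of_histGood minActionRegPr_descend_mono)
open Summit.QuantumFields.YangMills.Theorems.FluctuationComparisonRegPrIntLS2BetaSymmetriesLiftOfCritical (thm1Pair_five thm1Pair_allL_of_three)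
open Summit.QuantumFields.YangMills.Theorems.FluctuationComparisonRegPrIntLArgminOrbitOfUniqueCriticalOrbit (argmin_eq_orbit_of_pairwise)
open Summit.QuantumFields.YangMills.Theorems.FluctuationComparisonRegPrIntLS2BetaResidualGauge (residual_of_descTransf_eq_one)

/-! ## §1 The EQUALITY chain: an argmin good history is an (8)-minimiser's residual translate at every depth — REG-ARGMIN̄ and ORB∘ from the Thm-1 PAIR -/

section Chain

variable {F : T3Family}

/-- A good history with `J` free top steps is a good history with `n ≥ J` free top steps (fewer constrained heights). [cite: Balaban1985UV3, (7) p.257] -/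
theorem histGood_mono_free {θ : ℕ → ℝ} {J n K : ℕ} (hJn : J ≤ n) {U : GaugeField (F.P K) 0 (Matrix.specialUnitaryGroup (Fin 2) ℂ)}
    (hU : U ∈ histGood F ℰp θ K J) : U ∈ histGood F ℰp θ K n :=
  fun j hj => hU j (by omega)

/-- ★★★★★ **THE EQUALITY CHAIN**: given the Thm-1 pair at `L`, a member, `ε₀ ≤ a₀`, a history profile `θ` with `0 < θ i ≤ a₁`, `B₃·θ i·L³ ≤ ε₀`, `4·θ i·L³ < ε₀`, depth
`K − J ≥ 1`: every good history `U` over `V` with `A(U) = minActionRegPr F J K ε₀ V` lies on the RESIDUAL ORBIT (print's group (4)) of an (8)-minimiser `U_J` of Thm 1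
(`OnMinimalOrbit (B₃·θ J) V U_J`).  Descending induction on the depth: `U` is (6)(ε₀)-regular over `D_{n,K}U` (depth 1 directly, lit ✓`regPr_of_plaqSmall`; deeper from the
level above by gauge invariance of (2), lit ✓`regPr_gaugeAct_iff`, and FILE C's room ✓`regPr_of_regPr_succ`), `A(U) = m_n` (FILE C ✓`minActionRegPr_descend_mono` ∧
✓`minActionRegPr_le_action_of_histGood` squeeze), hence `U` minimises over (6)(ε₀) there and Thm 1 sentence 2 (`Thm1UniqueMinOrbitAt`) puts it on the orbit of the
(8)-minimiser of Thm 1 sentence 1 (`Thm1GlobalMinAt`). [cite: Balaban1985Variational, Thm 1 (8) p.279, (4)-(8) p.278, Prop. 7 p.299; Balaban1985UV3, (41)-(42) p.266; Balaban1987RG1, (0.11) p.253] -/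
theorem exists_onMinimalOrbit_sameOrbit_of_argmin {L : ℕ} {a₀ a₁ B₃ : ℝ} (hT : Thm1GlobalMinAt L a₀ a₁ B₃) (hU1 : Thm1UniqueMinOrbitAt L a₀ a₁ B₃)
    (hB₃ : 0 < B₃) (hFL : F.L = L) {ε₀ : ℝ} (hε₀ : 0 < ε₀) (hε₀a : ε₀ ≤ a₀) {θ : ℕ → ℝ} (hθpos : ∀ i, 0 < θ i)
    (hθa : ∀ i, θ i ≤ a₁) (hθB : ∀ i, B₃ * θ i * (F.L : ℝ) ^ 3 ≤ ε₀) (hθ4 : ∀ i, 4 * θ i * (F.L : ℝ) ^ 3 < ε₀)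
    {J K : ℕ} (hJK : J < K) {V : GaugeField (F.P J) 0 (Matrix.specialUnitaryGroup (Fin 2) ℂ)}
    {U : GaugeField (F.P K) 0 (Matrix.specialUnitaryGroup (Fin 2) ℂ)} (hUf : U ∈ fibre F ℰp J K hJK.le V) (hUg : U ∈ histGood F ℰp θ K J)
    (hA : wilsonAction4 U = minActionRegPr F J K hJK.le ε₀ V) :
    ∃ UJ : GaugeField (F.P K) 0 (Matrix.specialUnitaryGroup (Fin 2) ℂ),
      (varProblem3 F J K hJK.le).OnMinimalOrbit (B₃ * θ J) V UJ ∧ SameOrbit F J K hJK.le UJ U := by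
  have hL1 : (1 : ℝ) ≤ (F.L : ℝ) := by have := F.hL.2; exact_mod_cast (by omega : 1 ≤ F.L)
  have hL0 : (0 : ℝ) < (F.L : ℝ) := by linarith
  have hL3 : (1 : ℝ) ≤ (F.L : ℝ) ^ 3 := one_le_pow₀ hL1
  have hBθ : ∀ i, B₃ * θ i ≤ ε₀ := fun i => by
    have h1 : B₃ * θ i * 1 ≤ B₃ * θ i * (F.L : ℝ) ^ 3 := mul_le_mul_of_nonneg_left hL3 (mul_pos hB₃ (hθpos i)).le
    linarith [hθB i]
  -- Thm 1's pair at `(n, K)` over a `θ(n)`-small datum: an (8)-minimiser, and every (6)(ε₀)-minimiser on its residual orbit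
  have key : ∀ (n : ℕ) (hnK : n < K), J ≤ n → ∀ (U' : GaugeField (F.P K) 0 (Matrix.specialUnitaryGroup (Fin 2) ℂ)),
      U' ∈ regFibrePr F n K hnK.le ε₀ (descendTo F ℰp n K hnK.le U) →
      wilsonAction4 U' = minActionRegPr F n K hnK.le ε₀ (descendTo F ℰp n K hnK.le U) →
        ∃ Un : GaugeField (F.P K) 0 (Matrix.specialUnitaryGroup (Fin 2) ℂ),
          (varProblem3 F n K hnK.le).OnMinimalOrbit (B₃ * θ n) (descendTo F ℰp n K hnK.le U) Un ∧ SameOrbit F n K hnK.le Un U' := by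
    intro n hnK hJn U' hU'6 hA'
    have hWsmall : PlaqSmall (θ n) (descendTo F ℰp n K hnK.le U) := plaqSmall_descendTo_of_histGood F hUg hJn hnK.le
    obtain ⟨Un, hUn8, hmin⟩ := hT F hFL n K hnK (θ n) ε₀ (hθpos _) (hθa _) (hBθ _) hε₀a _ hWsmall
    have hon : (varProblem3 F n K hnK.le).OnMinimalOrbit (B₃ * θ n) (descendTo F ℰp n K hnK.le U) Un :=
      ⟨hUn8, hmin.on_subset (regFibrePr_mono F (hBθ _) _)⟩
    have huniq := hU1 F hFL n K hnK (θ n) ε₀ (hθpos _) (hθa _) (hBθ _) hε₀a _ hWsmall Un hon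
    refine ⟨Un, hon, huniq.2 U' hU'6 ?_⟩
    exact isMinOn_iff.mpr fun W hW => hA'.trans_le (minActionRegPr_le F hW)
  -- the equality chain, by induction on the depth `d = K − n ≥ 1`
  suffices hmain : ∀ (d n : ℕ) (hnK : n < K), K - n = d + 1 → J ≤ n →
      wilsonAction4 U = minActionRegPr F n K hnK.le ε₀ (descendTo F ℰp n K hnK.le U) →
        ∃ Un : GaugeField (F.P K) 0 (Matrix.specialUnitaryGroup (Fin 2) ℂ),
          (varProblem3 F n K hnK.le).OnMinimalOrbit (B₃ * θ n) (descendTo F ℰp n K hnK.le U) Un ∧ SameOrbit F n K hnK.le Un U by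
    have h := hmain (K - J - 1) J hJK (by omega) le_rfl (by rw [(mem_fibre_iff F ℰp).mp hUf]; exact hA)
    rwa [(mem_fibre_iff F ℰp).mp hUf] at h
  intro d
  induction d with
  | zero =>
    -- depth 1: `U` itself lies in (6)(ε₀) over `D_{K−1,K}U`
    intro n hnK hd hJn hAn
    have hK : K = n + 1 := by omega
    subst hK
    have hpl : PlaqSmall (θ (n + 1)) U := by
      have h := plaqSmall_descendTo_of_histGood F hUg (by omega : J ≤ n + 1) le_rfl
      rwa [descendTo_self] at h
    have hreg : RegPr F n (n + 1) ε₀ U := by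
      refine regPr_of_plaqSmall F hpl ?_ ?_
      · show θ (n + 1) ≤ ε₀ * ((F.L : ℝ)⁻¹) ^ (2 * (n + 1 - n))
        rw [show n + 1 - n = 1 by omega, mul_one, inv_pow, ← div_eq_mul_inv, le_div_iff₀ (pow_pos hL0 2)]
        have : (F.L : ℝ) ^ 2 ≤ (F.L : ℝ) ^ 3 := pow_le_pow_right₀ hL1 (by norm_num)
        nlinarith [hθ4 (n + 1), hθpos (n + 1)]
      · rw [show n + 1 - n = 1 by omega, mul_one, inv_pow, ← div_eq_mul_inv, lt_div_iff₀ (pow_pos hL0 3)]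
        linarith [hθ4 (n + 1)]
    exact key n hnK hJn U ((mem_regFibrePr_iff F).mpr ⟨(mem_fibre_iff F ℰp).mpr rfl, hreg⟩) hAn
  | succ d ih =>
    intro n hnK hd hJn hAn
    have hn1 : n + 1 < K := by omega
    -- `A(U) = m_n ≤ m_{n+1} ≤ A(U)`: equality one level up
    have hmono := minActionRegPr_descend_mono (F := F) hT hB₃ hFL hε₀a hθpos hθa hθB hUg hJn hn1
    have hup : minActionRegPr F (n + 1) K hn1.le ε₀ (descendTo F ℰp (n + 1) K hn1.le U) ≤ wilsonAction4 U :=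
      minActionRegPr_le_action_of_histGood (F := F) hT hB₃ hFL hε₀a hθpos hθa hθB hθ4 hn1.le
        ((mem_fibre_iff F ℰp).mpr rfl) (histGood_mono_free (by omega : J ≤ n + 1) hUg)
    have hAn1 : wilsonAction4 U = minActionRegPr F (n + 1) K hn1.le ε₀ (descendTo F ℰp (n + 1) K hn1.le U) := by
      apply le_antisymm _ hup
      exact hAn.trans_le hmono
    -- one level up: `U = w • U_{n+1}` with `U_{n+1} ∈ (8)` there, so `U ∈ RegPr F (n+1) K (B₃θ(n+1)) ⊆ RegPr F n K ε₀`
    obtain ⟨Un1, hon1, w, hw, hUw⟩ := ih (n + 1) hn1 (by omega) (by omega) hAn1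
    have hreg1 : RegPr F (n + 1) K (B₃ * θ (n + 1)) U := by
      rw [hUw, regPr_gaugeAct_iff F (mul_pos hB₃ (hθpos _)).le]
      exact ((mem_regFibrePr_iff F).mp hon1.1).2
    have hreg : RegPr F n K ε₀ U := regPr_of_regPr_succ F hn1.le (mul_pos hB₃ (hθpos _)).le (hθB _) hreg1
    exact key n hnK hJn U ((mem_regFibrePr_iff F).mpr ⟨(mem_fibre_iff F ℰp).mpr rfl, hreg⟩) hAn

/-- ★★★★★ **REG-ARGMIN̄ FROM THE THM-1 PAIR**: under §1's hypotheses (any depth `K − J ≥ 0`), a good history `U` over `V` with `A(U) = minActionRegPr F J K ε₀ V` is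
(6)(ε₀)-REGULAR: `U ∈ regFibrePr F J K hJK ε₀ V` (`U = w • U_J`, `U_J ∈ (8)(B₃θ J) ⊆ (6)(ε₀)`, (2) gauge-invariant). [cite: Balaban1985Variational, Thm 1 (8)-(10) p.279, (2)-(6) p.278] -/
theorem regPr_of_argmin {L : ℕ} {a₀ a₁ B₃ : ℝ} (hT : Thm1GlobalMinAt L a₀ a₁ B₃) (hU1 : Thm1UniqueMinOrbitAt L a₀ a₁ B₃)
    (hB₃ : 0 < B₃) (hFL : F.L = L) {ε₀ : ℝ} (hε₀ : 0 < ε₀) (hε₀a : ε₀ ≤ a₀) {θ : ℕ → ℝ} (hθpos : ∀ i, 0 < θ i)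
    (hθa : ∀ i, θ i ≤ a₁) (hθB : ∀ i, B₃ * θ i * (F.L : ℝ) ^ 3 ≤ ε₀) (hθ4 : ∀ i, 4 * θ i * (F.L : ℝ) ^ 3 < ε₀)
    {J K : ℕ} (hJK : J ≤ K) {V : GaugeField (F.P J) 0 (Matrix.specialUnitaryGroup (Fin 2) ℂ)}
    {U : GaugeField (F.P K) 0 (Matrix.specialUnitaryGroup (Fin 2) ℂ)} (hUf : U ∈ fibre F ℰp J K hJK V) (hUg : U ∈ histGood F ℰp θ K J)
    (hA : wilsonAction4 U = minActionRegPr F J K hJK ε₀ V) :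
    U ∈ regFibrePr F J K hJK ε₀ V := by
  rcases Nat.eq_or_lt_of_le hJK with hEq | hlt
  · -- depth 0: `U = V`
    subst hEq
    have hL0 : (0 : ℝ) < (F.L : ℝ) := by have := F.hL.2; exact_mod_cast (by omega : 0 < F.L)
    have hpl : PlaqSmall (θ J) U := by
      have h := plaqSmall_descendTo_of_histGood F hUg le_rfl le_rfl
      rwa [descendTo_self] at h
    have hL3 : (1 : ℝ) ≤ (F.L : ℝ) ^ 3 := one_le_pow₀ (by exact_mod_cast (by have := F.hL.2; omega : 1 ≤ F.L))
    refine (mem_regFibrePr_iff F).mpr ⟨hUf, regPr_of_plaqSmall F hpl ?_ ?_⟩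
    · show θ J ≤ ε₀ * ((F.L : ℝ)⁻¹) ^ (2 * (J - J))
      rw [Nat.sub_self, mul_zero, pow_zero, mul_one]
      nlinarith [hθ4 J, hθpos J]
    · rw [Nat.sub_self, mul_zero, pow_zero, mul_one]
      nlinarith [hθ4 J, hθpos J]
  · obtain ⟨UJ, hon, w, hw, hUw⟩ := exists_onMinimalOrbit_sameOrbit_of_argmin hT hU1 hB₃ hFL hε₀ hε₀a hθpos hθa hθB hθ4 hlt hUf hUg hA
    have hL3 : (1 : ℝ) ≤ (F.L : ℝ) ^ 3 := one_le_pow₀ (by exact_mod_cast (by have := F.hL.2; omega : 1 ≤ F.L))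
    have hBθ : B₃ * θ J ≤ ε₀ := by
      have h1 : B₃ * θ J * 1 ≤ B₃ * θ J * (F.L : ℝ) ^ 3 := mul_le_mul_of_nonneg_left hL3 (mul_pos hB₃ (hθpos J)).le
      linarith [hθB J]
    refine (mem_regFibrePr_iff F).mpr ⟨hUf, ?_⟩
    rw [hUw, regPr_gaugeAct_iff F hε₀.le]
    exact regPr_mono F hBθ ((mem_regFibrePr_iff F).mp hon.1).2

/-- ★★★★★ **ORB∘ FROM THE THM-1 PAIR**: two good histories over `V` realising `minActionRegPr F J K ε₀ V` lie on ONE orbit of print's group (4) (`SameOrbit`: both on `U_J`'s orbit by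
§1 + REG-ARGMIN̄ + Thm 1 sentence 2; lit ✓`sameOrbit_symm`∕`sameOrbit_trans`; depth 0 = ✓`sameOrbit_refl`). [cite: Balaban1985Variational, Thm 1 p.279, (4) p.278; Balaban1987RG1, (0.21) p.256] -/
theorem sameOrbit_of_argmin {L : ℕ} {a₀ a₁ B₃ : ℝ} (hT : Thm1GlobalMinAt L a₀ a₁ B₃) (hU1 : Thm1UniqueMinOrbitAt L a₀ a₁ B₃)
    (hB₃ : 0 < B₃) (hFL : F.L = L) {ε₀ : ℝ} (hε₀ : 0 < ε₀) (hε₀a : ε₀ ≤ a₀) {θ : ℕ → ℝ} (hθpos : ∀ i, 0 < θ i)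
    (hθa : ∀ i, θ i ≤ a₁) (hθB : ∀ i, B₃ * θ i * (F.L : ℝ) ^ 3 ≤ ε₀) (hθ4 : ∀ i, 4 * θ i * (F.L : ℝ) ^ 3 < ε₀)
    {J K : ℕ} (hJK : J ≤ K) {V : GaugeField (F.P J) 0 (Matrix.specialUnitaryGroup (Fin 2) ℂ)}
    {U U' : GaugeField (F.P K) 0 (Matrix.specialUnitaryGroup (Fin 2) ℂ)}
    (hUf : U ∈ fibre F ℰp J K hJK V) (hUg : U ∈ histGood F ℰp θ K J) (hA : wilsonAction4 U = minActionRegPr F J K hJK ε₀ V)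
    (hU'f : U' ∈ fibre F ℰp J K hJK V) (hU'g : U' ∈ histGood F ℰp θ K J) (hA' : wilsonAction4 U' = minActionRegPr F J K hJK ε₀ V) :
    SameOrbit F J K hJK U U' := by
  rcases Nat.eq_or_lt_of_le hJK with hEq | hlt
  · subst hEq
    have hU : U = V := by have h := (mem_fibre_iff F ℰp).mp hUf; rwa [descendTo_self] at h
    have hU' : U' = V := by have h := (mem_fibre_iff F ℰp).mp hU'f; rwa [descendTo_self] at h
    rw [hU, hU']
    exact sameOrbit_refl F hJK V
  · obtain ⟨UJ, hon, hUJU⟩ := exists_onMinimalOrbit_sameOrbit_of_argmin hT hU1 hB₃ hFL hε₀ hε₀a hθpos hθa hθB hθ4 hlt hUf hUg hA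
    -- `U′` is regular (REG-ARGMIN̄) and minimises over (6)(ε₀): on `UJ`'s orbit by Thm 1 sentence 2
    have hU'6 : U' ∈ regFibrePr F J K hJK ε₀ V := regPr_of_argmin hT hU1 hB₃ hFL hε₀ hε₀a hθpos hθa hθB hθ4 hJK hU'f hU'g hA'
    have hWsmall : PlaqSmall (θ J) V := by
      have h := plaqSmall_descendTo_of_histGood F hUg le_rfl hJK
      rwa [(mem_fibre_iff F ℰp).mp hUf] at h
    have hL3 : (1 : ℝ) ≤ (F.L : ℝ) ^ 3 := one_le_pow₀ (by exact_mod_cast (by have := F.hL.2; omega : 1 ≤ F.L))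
    have hBθ : B₃ * θ J ≤ ε₀ := by
      have h1 : B₃ * θ J * 1 ≤ B₃ * θ J * (F.L : ℝ) ^ 3 := mul_le_mul_of_nonneg_left hL3 (mul_pos hB₃ (hθpos J)).le
      linarith [hθB J]
    have huniq := hU1 F hFL J K hlt (θ J) ε₀ (hθpos _) (hθa _) hBθ hε₀a V hWsmall UJ hon
    have hUJU' : SameOrbit F J K hJK UJ U' :=
      huniq.2 U' hU'6 (isMinOn_iff.mpr fun W hW => hA'.trans_le (minActionRegPr_le F hW))
    exact sameOrbit_trans F hJK (sameOrbit_symm F hJK hUJU) hUJU'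

end Chain

/-! ## §2 REG-ARGMIN̄ and ORB∘ ON THE INTERIOR WINDOW, IN THE REGISTRY's (GAP♯∘ ∕ EXW∘) QUANTIFIER PREFIX: from the Thm-1 pair at one `L`; from the pair at every odd `L`;
from its `L = 3` instance; OUTRIGHT at every `L ≥ 5` -/

section Window

/-- ★★★★★ **REG-ARGMIN ∧ «`argminHist V` IS ONE RESIDUAL ORBIT» ON THE INTERIOR WINDOW, REGISTRY PREFIX, AT ONE BLOCK SIZE FROM THE THM-1 PAIR AT THAT BLOCK SIZE** (`c₀ := 1`,
`pS := 0`, `ε₁ := a₀`, `γ₁` so that `θBal(b₀)(i) ≤ min a₁ (ε₀∕(2(4+B₃)L³))`; the set-builder texts are ✓px17 g14's `argmin_eq_orbit_of_thm1Pair_of_regArgmin` VERBATIM; orbit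
equality by ✓`argmin_eq_orbit_of_pairwise`, residual by ✓`residual_of_descTransf_eq_one`). [cite: Balaban1985Variational, Thm 1 p.279, Prop. 7 p.299; Balaban1985UV3, (7) p.257, (41) p.266] -/
theorem argminRegularOrbit_at {L : ℕ} (hL1 : 1 < L) {a₀ a₁ B₃ : ℝ} (ha₀ : 0 < a₀) (ha₁ : 0 < a₁) (hB₃ : 0 < B₃)
    (hT : Thm1GlobalMinAt L a₀ a₁ B₃) (hU1 : Thm1UniqueMinOrbitAt L a₀ a₁ B₃) :
    ∃ c₀ : ℝ, 0 < c₀ ∧ c₀ ≤ 1 ∧ ∀ (cw : ℝ), 0 < cw → cw ≤ c₀ → ∃ pS : ℝ, ∀ (b₀ p₀ : ℝ), 0 < b₀ → pS ≤ p₀ → 0 < p₀ →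
      ∃ ε₁ : ℝ, 0 < ε₁ ∧ ∀ (ε₀ : ℝ), 0 < ε₀ → ε₀ ≤ ε₁ →
      ∃ γ₁ : ℝ, 0 < γ₁ ∧ ∀ (F : T3Family) (γ : ℝ), F.L = L → 0 < γ → γ ≤ γ₁ →
        ∀ (J K : ℕ) (hJK : J ≤ K) (V : GaugeField (F.P J) 0 (Matrix.specialUnitaryGroup (Fin 2) ℂ)), PlaqSmall (θBal F.L γ (cw * b₀) p₀ J) V →
          (∀ U' ∈ {U' | U' ∈ fibre F ℰp J K hJK V ∧ U' ∈ histGood F ℰp (θBal F.L γ b₀ p₀) K J ∧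
              wilsonAction4 U' = minActionRegPr F J K hJK ε₀ V}, RegPr F J K ε₀ U') ∧
          ∀ U₀ ∈ {U' | U' ∈ fibre F ℰp J K hJK V ∧ U' ∈ histGood F ℰp (θBal F.L γ b₀ p₀) K J ∧
              wilsonAction4 U' = minActionRegPr F J K hJK ε₀ V},
            {U' | U' ∈ fibre F ℰp J K hJK V ∧ U' ∈ histGood F ℰp (θBal F.L γ b₀ p₀) K J ∧
              wilsonAction4 U' = minActionRegPr F J K hJK ε₀ V} =
              {U | ∃ w : Site (F.P K) 0 → Matrix.specialUnitaryGroup (Fin 2) ℂ,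
                (∀ U' : GaugeField (F.P K) 0 (Matrix.specialUnitaryGroup (Fin 2) ℂ),
                    descendTo F ℰp J K hJK (GaugeField.gaugeAct w U') = descendTo F ℰp J K hJK U') ∧
                  U = GaugeField.gaugeAct w U₀} := by
  have hL : 1 ≤ L := hL1.le
  have hL0 : (0 : ℝ) < (L : ℝ) := by exact_mod_cast (show 0 < L by omega)
  refine ⟨1, one_pos, le_rfl, fun cw hcw0 hcw1 => ⟨0, fun b₀ p₀ hb _ hp => ⟨a₀, ha₀, fun ε₀ hε₀ hε₀a => ?_⟩⟩⟩
  set c : ℝ := 2 * (4 + B₃) * (L : ℝ) ^ 3 with hc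
  have hcpos : 0 < c := by positivity
  obtain ⟨γθ, hγθ, Hθ⟩ := exists_forall_θBal_le hL b₀ p₀ (lt_min ha₁ (div_pos hε₀ hcpos))
  refine ⟨min γθ 1, lt_min hγθ one_pos, fun F γ hFL hγ hγle J K hJK V _ => ?_⟩
  have hγθ' : γ ≤ γθ := hγle.trans (min_le_left _ _)
  have hγ1 : γ ≤ 1 := hγle.trans (min_le_right _ _)
  have hθle : ∀ i, θBal F.L γ b₀ p₀ i ≤ min a₁ (ε₀ / c) := fun i => by rw [hFL]; exact Hθ γ hγ hγθ' i
  have hθpos : ∀ i, 0 < θBal F.L γ b₀ p₀ i := fun i => θBal_pos F.hL.2.le hγ hγ1 hb p₀ i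
  have hθa : ∀ i, θBal F.L γ b₀ p₀ i ≤ a₁ := fun i => (hθle i).trans (min_le_left _ _)
  have hθc : ∀ i, θBal F.L γ b₀ p₀ i * c ≤ ε₀ := fun i => by
    have h := (hθle i).trans (min_le_right _ _)
    rwa [le_div_iff₀ hcpos] at h
  have hFL3 : (F.L : ℝ) ^ 3 = (L : ℝ) ^ 3 := by rw [hFL]
  have hθB : ∀ i, B₃ * θBal F.L γ b₀ p₀ i * (F.L : ℝ) ^ 3 ≤ ε₀ := fun i => by
    have h1 : B₃ * (F.L : ℝ) ^ 3 ≤ c := by rw [hFL3, hc]; nlinarith [pow_pos hL0 3]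
    calc B₃ * θBal F.L γ b₀ p₀ i * (F.L : ℝ) ^ 3 = θBal F.L γ b₀ p₀ i * (B₃ * (F.L : ℝ) ^ 3) := by ring
      _ ≤ θBal F.L γ b₀ p₀ i * c := mul_le_mul_of_nonneg_left h1 (hθpos i).le
      _ ≤ ε₀ := hθc i
  have hθ4 : ∀ i, 4 * θBal F.L γ b₀ p₀ i * (F.L : ℝ) ^ 3 < ε₀ := fun i => by
    have h1 : 4 * (F.L : ℝ) ^ 3 < c := by rw [hFL3, hc]; nlinarith [pow_pos hL0 3]
    calc 4 * θBal F.L γ b₀ p₀ i * (F.L : ℝ) ^ 3 = θBal F.L γ b₀ p₀ i * (4 * (F.L : ℝ) ^ 3) := by ring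
      _ < θBal F.L γ b₀ p₀ i * c := mul_lt_mul_of_pos_left h1 (hθpos i)
      _ ≤ ε₀ := hθc i
  refine ⟨fun U' hU' => ((mem_regFibrePr_iff F).mp
      (regPr_of_argmin hT hU1 hB₃ hFL hε₀ hε₀a hθpos hθa hθB hθ4 hJK hU'.1 hU'.2.1 hU'.2.2)).2, ?_⟩
  refine argmin_eq_orbit_of_pairwise F hJK V fun U₀ hU₀ U₁ hU₁ => ?_
  obtain ⟨w, hw, hU₁w⟩ := sameOrbit_of_argmin hT hU1 hB₃ hFL hε₀ hε₀a hθpos hθa hθB hθ4 hJK hU₀.1 hU₀.2.1 hU₀.2.2 hU₁.1 hU₁.2.1 hU₁.2.2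
  exact ⟨w, residual_of_descTransf_eq_one F hJK hw, hU₁w⟩

/-- ★★★★★ **THE SAME AT EVERY BLOCK SIZE FROM THE THM-1 PAIR LETTER** (✓`argmin_eq_orbit_of_thm1Pair_of_regArgmin`'s `hT`; its REG-ARGMIN hypothesis DELETED and REG-ARGMIN added
to the conclusion). [cite: Balaban1985Variational, Thm 1 p.279, Prop. 7 p.299] -/
theorem argminRegularOrbit_of_thm1Pair
    (hT : ∀ L : ℕ, Odd L → 1 < L → ∃ a₀ a₁ B₃ : ℝ, 0 < a₀ ∧ 0 < a₁ ∧ 0 < B₃ ∧ Thm1GlobalMinAt L a₀ a₁ B₃ ∧ Thm1UniqueMinOrbitAt L a₀ a₁ B₃) :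
    ∀ (L : ℕ), ∃ c₀ : ℝ, 0 < c₀ ∧ c₀ ≤ 1 ∧ ∀ (cw : ℝ), 0 < cw → cw ≤ c₀ → ∃ pS : ℝ, ∀ (b₀ p₀ : ℝ), 0 < b₀ → pS ≤ p₀ → 0 < p₀ →
      ∃ ε₁ : ℝ, 0 < ε₁ ∧ ∀ (ε₀ : ℝ), 0 < ε₀ → ε₀ ≤ ε₁ →
      ∃ γ₁ : ℝ, 0 < γ₁ ∧ ∀ (F : T3Family) (γ : ℝ), F.L = L → 0 < γ → γ ≤ γ₁ →
        ∀ (J K : ℕ) (hJK : J ≤ K) (V : GaugeField (F.P J) 0 (Matrix.specialUnitaryGroup (Fin 2) ℂ)), PlaqSmall (θBal F.L γ (cw * b₀) p₀ J) V →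
          (∀ U' ∈ {U' | U' ∈ fibre F ℰp J K hJK V ∧ U' ∈ histGood F ℰp (θBal F.L γ b₀ p₀) K J ∧
              wilsonAction4 U' = minActionRegPr F J K hJK ε₀ V}, RegPr F J K ε₀ U') ∧
          ∀ U₀ ∈ {U' | U' ∈ fibre F ℰp J K hJK V ∧ U' ∈ histGood F ℰp (θBal F.L γ b₀ p₀) K J ∧
              wilsonAction4 U' = minActionRegPr F J K hJK ε₀ V},
            {U' | U' ∈ fibre F ℰp J K hJK V ∧ U' ∈ histGood F ℰp (θBal F.L γ b₀ p₀) K J ∧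
              wilsonAction4 U' = minActionRegPr F J K hJK ε₀ V} =
              {U | ∃ w : Site (F.P K) 0 → Matrix.specialUnitaryGroup (Fin 2) ℂ,
                (∀ U' : GaugeField (F.P K) 0 (Matrix.specialUnitaryGroup (Fin 2) ℂ),
                    descendTo F ℰp J K hJK (GaugeField.gaugeAct w U') = descendTo F ℰp J K hJK U') ∧
                  U = GaugeField.gaugeAct w U₀} := by
  intro L
  by_cases hLodd : Odd L ∧ 1 < L
  · obtain ⟨a₀, a₁, B₃, ha₀, ha₁, hB₃, hT1, hU1⟩ := hT L hLodd.1 hLodd.2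
    exact argminRegularOrbit_at hLodd.2 ha₀ ha₁ hB₃ hT1 hU1
  · refine ⟨1, one_pos, le_rfl, fun cw _ _ => ⟨0, fun b₀ p₀ _ _ _ => ⟨1, one_pos, fun ε₀ _ _ => ⟨1, one_pos, ?_⟩⟩⟩⟩
    intro F γ hFL
    exact absurd (hFL ▸ F.hL) hLodd

/-- ★★★★★ **… FROM THE `L = 3` THM-1 PAIR ALONE** (every `L ≥ 5` by ✓`thm1Pair_five`; `L = 3` = the [Balaban1985RegularSpaces] Thm-2 socket, EMBARGO-LITE №58).
[cite: Balaban1985Variational, Thm 1 p.279; Balaban1985RegularSpaces, Thm 2 p.83] -/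
theorem argminRegularOrbit_of_thm1PairAtThree
    (h3 : ∃ a₀ a₁ B₃ : ℝ, 0 < a₀ ∧ 0 < a₁ ∧ 0 < B₃ ∧ Thm1GlobalMinAt 3 a₀ a₁ B₃ ∧ Thm1UniqueMinOrbitAt 3 a₀ a₁ B₃) :
    ∀ (L : ℕ), ∃ c₀ : ℝ, 0 < c₀ ∧ c₀ ≤ 1 ∧ ∀ (cw : ℝ), 0 < cw → cw ≤ c₀ → ∃ pS : ℝ, ∀ (b₀ p₀ : ℝ), 0 < b₀ → pS ≤ p₀ → 0 < p₀ →
      ∃ ε₁ : ℝ, 0 < ε₁ ∧ ∀ (ε₀ : ℝ), 0 < ε₀ → ε₀ ≤ ε₁ →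
      ∃ γ₁ : ℝ, 0 < γ₁ ∧ ∀ (F : T3Family) (γ : ℝ), F.L = L → 0 < γ → γ ≤ γ₁ →
        ∀ (J K : ℕ) (hJK : J ≤ K) (V : GaugeField (F.P J) 0 (Matrix.specialUnitaryGroup (Fin 2) ℂ)), PlaqSmall (θBal F.L γ (cw * b₀) p₀ J) V →
          (∀ U' ∈ {U' | U' ∈ fibre F ℰp J K hJK V ∧ U' ∈ histGood F ℰp (θBal F.L γ b₀ p₀) K J ∧
              wilsonAction4 U' = minActionRegPr F J K hJK ε₀ V}, RegPr F J K ε₀ U') ∧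
          ∀ U₀ ∈ {U' | U' ∈ fibre F ℰp J K hJK V ∧ U' ∈ histGood F ℰp (θBal F.L γ b₀ p₀) K J ∧
              wilsonAction4 U' = minActionRegPr F J K hJK ε₀ V},
            {U' | U' ∈ fibre F ℰp J K hJK V ∧ U' ∈ histGood F ℰp (θBal F.L γ b₀ p₀) K J ∧
              wilsonAction4 U' = minActionRegPr F J K hJK ε₀ V} =
              {U | ∃ w : Site (F.P K) 0 → Matrix.specialUnitaryGroup (Fin 2) ℂ,
                (∀ U' : GaugeField (F.P K) 0 (Matrix.specialUnitaryGroup (Fin 2) ℂ),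
                    descendTo F ℰp J K hJK (GaugeField.gaugeAct w U') = descendTo F ℰp J K hJK U') ∧
                  U = GaugeField.gaugeAct w U₀} :=
  argminRegularOrbit_of_thm1Pair (thm1Pair_allL_of_three h3)

/-- ★★★★★ **REG-ARGMIN ∧ ORB∘ ON THE INTERIOR WINDOW AT EVERY BLOCK SIZE `L ≥ 5` — ZERO HYPOTHESES** (✓`thm1Pair_five` ∘ `argminRegularOrbit_at`): for the `SU(2)` d = 3 torus
family, every good history realising the regular minimum over an interior datum is (6)(ε₀)-regular, and all of them form one orbit of print's group (4).
[cite: Balaban1985Variational, Thm 1 (8)-(10) p.279, Prop. 7 p.299; Balaban1987RG1, (0.21) p.256] -/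
theorem argminRegularOrbit_body_five (L : ℕ) (h5 : 5 ≤ L) : ∃ c₀ : ℝ, 0 < c₀ ∧ c₀ ≤ 1 ∧ ∀ (cw : ℝ), 0 < cw → cw ≤ c₀ → ∃ pS : ℝ, ∀ (b₀ p₀ : ℝ), 0 < b₀ → pS ≤ p₀ → 0 < p₀ →
      ∃ ε₁ : ℝ, 0 < ε₁ ∧ ∀ (ε₀ : ℝ), 0 < ε₀ → ε₀ ≤ ε₁ →
      ∃ γ₁ : ℝ, 0 < γ₁ ∧ ∀ (F : T3Family) (γ : ℝ), F.L = L → 0 < γ → γ ≤ γ₁ →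
        ∀ (J K : ℕ) (hJK : J ≤ K) (V : GaugeField (F.P J) 0 (Matrix.specialUnitaryGroup (Fin 2) ℂ)), PlaqSmall (θBal F.L γ (cw * b₀) p₀ J) V →
          (∀ U' ∈ {U' | U' ∈ fibre F ℰp J K hJK V ∧ U' ∈ histGood F ℰp (θBal F.L γ b₀ p₀) K J ∧
              wilsonAction4 U' = minActionRegPr F J K hJK ε₀ V}, RegPr F J K ε₀ U') ∧
          ∀ U₀ ∈ {U' | U' ∈ fibre F ℰp J K hJK V ∧ U' ∈ histGood F ℰp (θBal F.L γ b₀ p₀) K J ∧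
              wilsonAction4 U' = minActionRegPr F J K hJK ε₀ V},
            {U' | U' ∈ fibre F ℰp J K hJK V ∧ U' ∈ histGood F ℰp (θBal F.L γ b₀ p₀) K J ∧
              wilsonAction4 U' = minActionRegPr F J K hJK ε₀ V} =
              {U | ∃ w : Site (F.P K) 0 → Matrix.specialUnitaryGroup (Fin 2) ℂ,
                (∀ U' : GaugeField (F.P K) 0 (Matrix.specialUnitaryGroup (Fin 2) ℂ),
                    descendTo F ℰp J K hJK (GaugeField.gaugeAct w U') = descendTo F ℰp J K hJK U') ∧
                  U = GaugeField.gaugeAct w U₀} := by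
  obtain ⟨a₀, a₁, B₃, ha₀, ha₁, hB₃, hT1, hU1⟩ := thm1Pair_five L h5
  exact argminRegularOrbit_at (by omega) ha₀ ha₁ hB₃ hT1 hU1

end Window

end Summit.QuantumFields.YangMills.Theorems.FluctuationComparisonRegPrIntLS2BetaArgminOrbitOfTower

end
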